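import Literature.NumberTheory.K2Lit.UnitarySUTamagawaDensity              -- ★ leaf #2: `suLocal`, `suLevelTwoP`, `suIntegralLevel` (+ ★ D1 `Weil1982.UnitaryFinCentralizerTopFormHaar`)
import Literature.NumberTheory.Weil1982.UnitaryFinTopFormDualLatticeCompact  -- ★ `transpose_map_mat_mul_localForm_mul_mat`, `isUnit_det_localForm`, `localForm_eq_map`, `conjLocal_conjLocal`
import Literature.NumberTheory.Weil1982.UnitaryFinTopFormLevelOneGoodPlace   -- ★ `centralizer_one_inf_eq`
import Literature.AnabelianGeometry.EtaleTheta.Discharge.Sec2ClassTwoCommutators  -- ★ `ClassTwo.relIndex_sup_eq_relIndex` (`[K·N : K] = [N : K ∩ N]`, `N` normal; Mathlib-only module)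
import HarnessLib

/-!
# K2 ∕ E5 «TamagawaUnitary», unit F (BETA-GAUGE) — helper `K2E5BetaDetIndexCalculus`: index calculus along a homomorphism, the kernel
# `SU = ker det` of the local unitary group, and the rank-one (`U₁`) reading of determinants

Cell `hodgecm-mathlib` (Track B «K2-LIT»), floor 0, item h413 = `stmt-HodgeConjecture-24833`; tier-1 socket module
`Cruxes/H413/Lines/K2_E5_TamagawaUnitary_BetaGauge.lean` (K2E5-plan (g0), sha16 11aab11c56dfa296), sockets F4 `sig_K2E5BetaSUGoodPlaceDensity` (p19) and F5
`sig_K2E5BetaGoodPlaceMultiplicative` (p06).  PROOF lane, helper file (`--supports stmt-HodgeConjecture-24833 --as helper`); author K2E5-p19 (g0).  Road of record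
(K2/STATUS.md 22:01Z∕22:03Z, p19 ⊕ p06): `ρ^{U₂}_v = ρ^{SU}_v · ρ^{U₁}_v` = (G) GROUP SIDE `[U₂(𝒪_v) : K_U(2p)] = [SU(𝒪_v) : K′(2p)] · [U₁(𝒪_v) : K_{U₁}(2p)]`
(this seat; files `K2E5BetaDetIndexCalculus` → `K2E5BetaDetQuasiReflection` → `K2E5BetaDetIndexFactorization`) × (L) LIE SIDE (p06); F4 = F5 ÷ ★ values (p06's ★
`K2E5BetaGoodPlaceUDensity`).  THIS FILE = the abstract and the cheap concrete ingredients of (G):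

* §1 INDEX CALCULUS ALONG A HOMOMORPHISM (pure group theory, Mathlib + ★ `ClassTwo.relIndex_sup_eq_relIndex` = `[K·N : K] = [N : K ∩ N]` for `N` normal — Mathlib's
  `relIndex_sup_left` has normality on the wrong side): `relIndex_eq_relIndex_inf_ker_mul` — for `f : G →* G'` and `K ≤ Γ`: **`[Γ : K] = [Γ ∩ ker f : K ∩ ker f] · [f(Γ) : f(K)]`**.
* §2 DETERMINANTS IN `U(H)(L⁺_v)`: the determinant of an integral matrix is integral (`det_mem_localIntegers`); `conj(det g)·det g = 1` for `g ∈ U(H)(L⁺_v)` (`conjLocal_det_mul_det`);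
  for `N = 2`, `g ≡ 1 (2p)` forces `det g ≡ 1 (2p)` (`exists_det_eq_one_add_twoP_mul`); `SU(H)(L⁺_v) = ker (det : U(H)(L⁺_v) →* E_vˣ)` (`suLocal_eq_ker`) and hence
  `K_U(2p) ∩ ker = K′`, `U(𝒪_v) ∩ ker = SU(𝒪_v)` in ★'s centraliser-at-`1` currency.
* §3 THE RANK-ONE GROUP `U₁ = U((1))`: `mat γ` is the scalar `(mat γ)₀₀`, `det` is injective on `U₁(L⁺_v)`, every `σ`-norm-one unit `u` is `det` of the scalar element
  `γ(u) ∈ U₁(L⁺_v)` (★ `scalar_mem_unitaryGroupOfForm`), and the integral level ∕ level `2p` of `U₁` read on `u`, `u⁻¹`.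

HONEST LABEL: HC_CM is proved only modulo the 7 printed citations (2 remaining named inputs: hLiu418 = stmt-HodgeConjecture-24832,
h413 = stmt-HodgeConjecture-24833) until rung 0 closes; this helper closes no socket and changes no count.

## References
* [Weil1982] A. Weil, *Adeles and Algebraic Groups*, Progress in Math. 23 (1982) — Ch. II §2.2 (local measures `|ω|_v`), §2.4 p. 22 (isogenies ∕ exact sequences and local factors).
* [PlatonovRapinchuk1994] V. Platonov, A. Rapinchuk, *Algebraic Groups and Number Theory* (1994) — §2.3 (`SU`, `U`, `det`), §3.3 (congruence subgroups), §3.5 (volumes of `𝒪_v`-points).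
* [Ono1963] T. Ono, *On the Tamagawa number of algebraic tori*, Ann. of Math. 78 (1963) — Main Thm. (relative Tamagawa numbers along exact sequences; the `U₁ = U∕SU` bookkeeping).
-/

set_option autoImplicit false
set_option linter.dupNamespace false

noncomputable section

namespace Summit.HodgeConjecture.HodgeConjecture.Cruxes.H413.K2E5BetaDetIndexCalculus

open NumberField IsDedekindDomain
open Literature.NumberTheory.Automorphic Literature.NumberTheory.Automorphic.UnitaryGroup
open Literature.NumberTheory.Weil1982.UnitaryFinTopForm
open Literature.NumberTheory.K2Lit.UnitarySUTamagawaDensity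
open scoped MatrixGroups Matrix

/-! ## §1 Index calculus along a homomorphism -/

section IndexCalculus

variable {G G' : Type*} [Group G] [Group G']

/-- **INDEX CALCULUS ALONG A HOMOMORPHISM**: for `f : G →* G'` and subgroups `K ≤ Γ`, **`[Γ : K] = [Γ ∩ ker f : K ∩ ker f] · [f(Γ) : f(K)]`** — the exact sequence
`1 → (Γ ∩ ker f)∕(K ∩ ker f) → Γ∕K → f(Γ)∕f(K) → 1` of pointed coset sets (`[Γ : K] = [Γ : K·(Γ ∩ ker f)]·[K·(Γ ∩ ker f) : K]`, the first factor `= [f Γ : f K]`, the second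
`= [Γ ∩ ker f : K ∩ ker f]` by ★ `ClassTwo.relIndex_sup_eq_relIndex`).  Stated with Mathlib's `Subgroup.relIndex` (`A.relIndex B = [B : A ∩ B]`); no finiteness needed.
[cite: Ono1963, Main Thm.] [cite: PlatonovRapinchuk1994, §2.3] -/
theorem relIndex_eq_relIndex_inf_ker_mul (f : G →* G') {K Γ : Subgroup G} (hKΓ : K ≤ Γ) :
    K.relIndex Γ = (K ⊓ f.ker).relIndex (Γ ⊓ f.ker) * (K.map f).relIndex (Γ.map f) := by
  -- pass to the ambient group `Γ`
  set f' : Γ →* G' := f.comp Γ.subtype with hf'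
  set K' : Subgroup Γ := K.subgroupOf Γ with hK'
  have hmapK : K.map f = K'.map f' := by
    rw [hf', hK', ← Subgroup.map_map, Subgroup.subgroupOf_map_subtype, inf_of_le_left hKΓ]
  have hmapΓ : Γ.map f = (⊤ : Subgroup Γ).map f' := by
    rw [hf', ← Subgroup.map_map, ← MonoidHom.range_eq_map, Subgroup.range_subtype]
  have hker : (K ⊓ f.ker).relIndex (Γ ⊓ f.ker) = (K' ⊓ f'.ker).relIndex f'.ker := by
    rw [← Subgroup.relIndex_subgroupOf (inf_le_left : Γ ⊓ f.ker ≤ Γ)]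
    have e1 : (K ⊓ f.ker).subgroupOf Γ = K' ⊓ f'.ker := by
      rw [hK', hf', Subgroup.subgroupOf, Subgroup.comap_inf, ← MonoidHom.comap_ker]
      rfl
    have e2 : (Γ ⊓ f.ker).subgroupOf Γ = f'.ker := by
      rw [hf', Subgroup.subgroupOf, Subgroup.comap_inf, ← MonoidHom.comap_ker, ← Subgroup.subgroupOf, Subgroup.subgroupOf_self, top_inf_eq]
    rw [e1, e2]
  rw [hmapK, hmapΓ, hker, Subgroup.relIndex_map_map, top_sup_eq, Subgroup.relIndex_top_right, Subgroup.inf_relIndex_right,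
    ← Literature.AnabelianGeometry.EtaleTheta.ClassTwo.relIndex_sup_eq_relIndex K' f'.ker, Subgroup.relIndex_mul_index (le_sup_left : K' ≤ K' ⊔ f'.ker)]
  rfl

end IndexCalculus

/-! ## §2 Determinants in `U(H)(L⁺_v)`: integrality, norm one, level, and `SU = ker det` -/

section Det

variable (L : Type) [Field L] [NumberField L] [IsCMField L] (N : ℕ) (H : Matrix (Fin N) (Fin N) L)
  (v : HeightOneSpectrum (𝓞 ↥(maximalRealSubfield L)))

omit [IsCMField L] in
/-- The determinant of an integral matrix is integral (`det` commutes with the inclusion `M_N(𝒪_{E_v}) → M_N(E_v)`). [cite: PlatonovRapinchuk1994, §3.3] -/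
theorem det_mem_localIntegers {X : Matrix (Fin N) (Fin N) (LocalRing L v)} (hX : X ∈ intMatrices L N v) : X.det ∈ localIntegers L v := by
  set X' : Matrix (Fin N) (Fin N) (localIntegers L v) := fun i j => ⟨X i j, (mem_intMatrices_iff L N v X).1 hX i j⟩ with hX'
  have e : X = (localIntegers L v).subtype.mapMatrix X' := by
    ext i j; rfl
  rw [e, ← RingHom.map_det]
  exact SetLike.coe_mem _

/-- **`conj(det g) · det g = 1`** for `g ∈ U(H)(L⁺_v)` with `det H ≠ 0`: take determinants in `ᵗ(conj g) H_v g = H_v` and cancel the unit `det H_v`.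
[cite: PlatonovRapinchuk1994, §2.3] -/
theorem conjLocal_det_mul_det (hdet : H.det ≠ 0) (g : (cmDatum L N H).Local v) :
    conjLocal L (IsCMField.complexConj L) v (mat L N H v g).det * (mat L N H v g).det = 1 := by
  have h := congrArg Matrix.det (transpose_map_mat_mul_localForm_mul_mat L N H v g)
  rw [Matrix.det_mul, Matrix.det_mul, Matrix.det_transpose, ← RingHom.mapMatrix_apply, ← RingHom.map_det] at h
  have hu := isUnit_det_localForm L N H v hdet
  have h' : (conjLocal L (IsCMField.complexConj L) v (mat L N H v g).det * (mat L N H v g).det) * (localForm L N H v).det =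
      1 * (localForm L N H v).det := by
    rw [one_mul, mul_assoc, mul_comm (mat L N H v g).det, ← mul_assoc]; exact h
  exact hu.mul_right_cancel h'

/-- `det (mat g⁻¹) · det (mat g) = 1`. [cite: PlatonovRapinchuk1994, §2.3] -/
theorem det_mat_inv_mul_det_mat (g : (cmDatum L N H).Local v) : (mat L N H v g⁻¹).det * (mat L N H v g).det = 1 := by
  rw [← Matrix.det_mul, mat_inv_mul, Matrix.det_one]

/-- The determinant hom `U(H)(L⁺_v) →* E_vˣ` (Mathlib's `GL_N →det` composed with the subgroup inclusion) evaluates to `det (mat g)`. [cite: PlatonovRapinchuk1994, §2.3] -/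
theorem coe_det_subtype_apply (g : (cmDatum L N H).Local v) :
    ((Matrix.GeneralLinearGroup.det.comp (Subgroup.subtype _) : (cmDatum L N H).Local v →* (LocalRing L v)ˣ) g : LocalRing L v) = (mat L N H v g).det :=
  rfl

/-- **`SU(H)(L⁺_v) = ker det`** (★ leaf #2's `suLocal = {g : det (mat g) = 1}`). [cite: PlatonovRapinchuk1994, §2.3] -/
theorem suLocal_eq_ker :
    suLocal L N H v = (Matrix.GeneralLinearGroup.det.comp (Subgroup.subtype _) : (cmDatum L N H).Local v →* (LocalRing L v)ˣ).ker := by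
  ext g
  rw [mem_suLocal_iff, MonoidHom.mem_ker, ← Units.val_eq_one, coe_det_subtype_apply]

/-- `K_U(2p) ∩ ker det = K′(2p)` (★ leaf #2's `suLevelTwoP = levelTwoP 1 ⊓ suLocal`). [cite: PlatonovRapinchuk1994, §3.3] -/
theorem levelTwoP_inf_ker_eq_suLevelTwoP :
    levelTwoP L N H v 1 ⊓ (Matrix.GeneralLinearGroup.det.comp (Subgroup.subtype _) : (cmDatum L N H).Local v →* (LocalRing L v)ˣ).ker = suLevelTwoP L N H v := by
  rw [← suLocal_eq_ker]; rfl

/-- `(Z(1) ∩ U(H)(𝒪_v)) ∩ ker det = SU(H)(𝒪_v)` (★ `centralizer_one_inf_eq`, ★ leaf #2's `suIntegralLevel = cmLocalIntegralLevel ⊓ suLocal`). [cite: PlatonovRapinchuk1994, §3.5] -/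
theorem centralizer_inf_level_inf_ker_eq_suIntegralLevel :
    (Subgroup.centralizer ({1} : Set ((cmDatum L N H).Local v)) ⊓ cmLocalIntegralLevel L N H v) ⊓
        (Matrix.GeneralLinearGroup.det.comp (Subgroup.subtype _) : (cmDatum L N H).Local v →* (LocalRing L v)ˣ).ker = suIntegralLevel L N H v := by
  rw [← suLocal_eq_ker, centralizer_one_inf_eq]; rfl

end Det

section DetTwo

variable (L : Type) [Field L] [NumberField L] [IsCMField L] (v : HeightOneSpectrum (𝓞 ↥(maximalRealSubfield L)))

omit [IsCMField L] in
/-- **Level `2p` forces `det ≡ 1 (2p)` for `N = 2`**: if `X − 1 ∈ 2p·M₂(𝒪_{E_v})` then `det X = 1 + 2p·t` with `t ∈ 𝒪_{E_v}` (`det (1 + 2pY) = 1 + 2p(tr Y + 2p·det Y)`).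
[cite: PlatonovRapinchuk1994, §3.3] -/
theorem exists_det_eq_one_add_twoP_mul {X : Matrix (Fin 2) (Fin 2) (LocalRing L v)} (hX : X - 1 ∈ twoPIntMatrices L 2 v) :
    ∃ t ∈ localIntegers L v, X.det = 1 + twoP L v * t := by
  obtain ⟨Y, hY, hYX⟩ := (mem_twoPIntMatrices_iff L 2 v _).1 hX
  have hXe : X = 1 + twoP L v • Y := by rw [hYX, add_sub_cancel]
  have hYi := (mem_intMatrices_iff L 2 v Y).1 hY
  have h2p : twoP L v ∈ localIntegers L v := by rw [twoP]; exact natCast_mem _ _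
  refine ⟨Y 0 0 + Y 1 1 + twoP L v * (Y 0 0 * Y 1 1 - Y 0 1 * Y 1 0), ?_, ?_⟩
  · exact add_mem (add_mem (hYi 0 0) (hYi 1 1)) (mul_mem h2p (sub_mem (mul_mem (hYi 0 0) (hYi 1 1)) (mul_mem (hYi 0 1) (hYi 1 0))))
  · rw [hXe, Matrix.det_fin_two]
    simp only [Matrix.add_apply, Matrix.one_apply_eq, Matrix.one_apply_ne (show (0 : Fin 2) ≠ 1 by decide),
      Matrix.one_apply_ne (show (1 : Fin 2) ≠ 0 by decide), Matrix.smul_apply, smul_eq_mul, zero_add]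
    ring

end DetTwo

/-! ## §3 The rank-one group `U₁ = U((1))(L⁺_v)`: matrices are scalars, `det` is injective, norm-one units are determinants -/

section RankOne

variable (L : Type) [Field L] [NumberField L] [IsCMField L] (v : HeightOneSpectrum (𝓞 ↥(maximalRealSubfield L)))

/-- `det (mat γ) = (mat γ)₀₀` in `U₁`. [cite: PlatonovRapinchuk1994, §2.3] -/
theorem det_mat_rankOne (γ : (cmDatum L 1 (1 : Matrix (Fin 1) (Fin 1) L)).Local v) :
    (mat L 1 (1 : Matrix (Fin 1) (Fin 1) L) v γ).det = mat L 1 (1 : Matrix (Fin 1) (Fin 1) L) v γ 0 0 :=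
  Matrix.det_fin_one _

omit [IsCMField L] in
/-- A `1 × 1` matrix over `E_v` is integral iff its entry is. [cite: PlatonovRapinchuk1994, §3.3] -/
theorem mem_intMatrices_one_iff (X : Matrix (Fin 1) (Fin 1) (LocalRing L v)) : X ∈ intMatrices L 1 v ↔ X 0 0 ∈ localIntegers L v := by
  rw [mem_intMatrices_iff]
  refine ⟨fun h => h 0 0, fun h i j => ?_⟩
  rw [Subsingleton.elim i 0, Subsingleton.elim j 0]; exact h

omit [IsCMField L] in
/-- A `1 × 1` matrix lies in `2p·M₁(𝒪_{E_v})` iff its entry is `2p·t` with `t` integral. [cite: PlatonovRapinchuk1994, §3.3] -/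
theorem mem_twoPIntMatrices_one_iff (X : Matrix (Fin 1) (Fin 1) (LocalRing L v)) :
    X ∈ twoPIntMatrices L 1 v ↔ ∃ t ∈ localIntegers L v, X 0 0 = twoP L v * t := by
  rw [mem_twoPIntMatrices_iff]
  constructor
  · rintro ⟨Y, hY, rfl⟩
    exact ⟨Y 0 0, (mem_intMatrices_one_iff L v Y).1 hY, by rw [Matrix.smul_apply, smul_eq_mul]⟩
  · rintro ⟨t, ht, hXt⟩
    refine ⟨Matrix.of fun _ _ => t, (mem_intMatrices_one_iff L v _).2 (by simpa using ht), ?_⟩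
    ext i j
    rw [Subsingleton.elim i 0, Subsingleton.elim j 0, Matrix.smul_apply, Matrix.of_apply, smul_eq_mul, hXt]

/-- **`det` is injective on `U₁(L⁺_v)`** (a `1 × 1` matrix is its determinant). [cite: PlatonovRapinchuk1994, §2.3] -/
theorem det_subtype_injective_rankOne :
    Function.Injective (Matrix.GeneralLinearGroup.det.comp (Subgroup.subtype _) :
      (cmDatum L 1 (1 : Matrix (Fin 1) (Fin 1) L)).Local v →* (LocalRing L v)ˣ) := by
  intro γ γ' h
  have h' := congrArg Units.val h
  rw [coe_det_subtype_apply, coe_det_subtype_apply, det_mat_rankOne, det_mat_rankOne] at h'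
  refine Subtype.ext (Units.ext (Matrix.ext fun i j => ?_))
  rw [Subsingleton.elim i 0, Subsingleton.elim j 0]
  exact h'

/-- The scalar element `γ(u) ∈ U₁(L⁺_v)` attached to a unit `u ∈ E_vˣ` of `σ`-norm one (★ `scalar_mem_unitaryGroupOfForm`; no condition on the form). [cite: PlatonovRapinchuk1994, §2.3] -/
theorem scalar_mem_local (u : (LocalRing L v)ˣ) (hu : conjLocal L (IsCMField.complexConj L) v u * u = 1) :
    Units.map (Matrix.scalar (Fin 1) : LocalRing L v →+* Matrix (Fin 1) (Fin 1) (LocalRing L v)).toMonoidHom u ∈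
      UnitaryGroup.«local» L (IsCMField.complexConj L) 1 (1 : Matrix (Fin 1) (Fin 1) L) v :=
  scalar_mem_unitaryGroupOfForm _ _ u hu

/-- The matrix of `γ(u)` is `u` (as a `1 × 1` matrix: entry `(0,0)`). [cite: PlatonovRapinchuk1994, §2.3] -/
theorem mat_scalar_apply (u : (LocalRing L v)ˣ) (hu : conjLocal L (IsCMField.complexConj L) v u * u = 1) (i j : Fin 1) :
    mat L 1 (1 : Matrix (Fin 1) (Fin 1) L) v ⟨_, scalar_mem_local L v u hu⟩ i j = u := by
  rw [Subsingleton.elim i 0, Subsingleton.elim j 0, mat_def]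
  show ((Matrix.scalar (Fin 1) : LocalRing L v →+* Matrix (Fin 1) (Fin 1) (LocalRing L v)) u) 0 0 = u
  rw [Matrix.scalar_apply, Matrix.diagonal_apply_eq]

/-- The matrix of `γ(u)⁻¹` is `u⁻¹`. [cite: PlatonovRapinchuk1994, §2.3] -/
theorem mat_scalar_inv_apply (u : (LocalRing L v)ˣ) (hu : conjLocal L (IsCMField.complexConj L) v u * u = 1) (i j : Fin 1) :
    mat L 1 (1 : Matrix (Fin 1) (Fin 1) L) v (⟨_, scalar_mem_local L v u hu⟩)⁻¹ i j = ↑u⁻¹ := by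
  rw [Subsingleton.elim i 0, Subsingleton.elim j 0, mat_def]
  show ((Matrix.scalar (Fin 1) : LocalRing L v →+* Matrix (Fin 1) (Fin 1) (LocalRing L v)) ↑u⁻¹) 0 0 = ↑u⁻¹
  rw [Matrix.scalar_apply, Matrix.diagonal_apply_eq]

/-- `det γ(u) = u`. [cite: PlatonovRapinchuk1994, §2.3] -/
theorem det_subtype_scalar (u : (LocalRing L v)ˣ) (hu : conjLocal L (IsCMField.complexConj L) v u * u = 1) :
    (Matrix.GeneralLinearGroup.det.comp (Subgroup.subtype _) : (cmDatum L 1 (1 : Matrix (Fin 1) (Fin 1) L)).Local v →* (LocalRing L v)ˣ)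
      ⟨_, scalar_mem_local L v u hu⟩ = u := by
  apply Units.ext
  rw [coe_det_subtype_apply, det_mat_rankOne, mat_scalar_apply L v u hu]

/-- **Integral level of `U₁` read on the scalar**: `γ ∈ U₁(𝒪_v) ↔ (mat γ)₀₀, (mat γ⁻¹)₀₀ ∈ 𝒪_{E_v}`. [cite: PlatonovRapinchuk1994, §3.5] -/
theorem mem_level_rankOne_iff (γ : (cmDatum L 1 (1 : Matrix (Fin 1) (Fin 1) L)).Local v) :
    γ ∈ cmLocalIntegralLevel L 1 (1 : Matrix (Fin 1) (Fin 1) L) v ↔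
      mat L 1 (1 : Matrix (Fin 1) (Fin 1) L) v γ 0 0 ∈ localIntegers L v ∧ mat L 1 (1 : Matrix (Fin 1) (Fin 1) L) v γ⁻¹ 0 0 ∈ localIntegers L v := by
  rw [mem_cmLocalIntegralLevel_iff_mat, mem_intMatrices_one_iff, mem_intMatrices_one_iff]

/-- **Level `2p` of `U₁` read on the scalar**: `γ ∈ K_{U₁}(2p) ↔ (mat γ)₀₀ = 1 + 2p·t ∧ (mat γ⁻¹)₀₀ = 1 + 2p·t'` with `t, t'` integral. [cite: PlatonovRapinchuk1994, §3.3] -/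
theorem mem_levelTwoP_rankOne_iff (γ : (cmDatum L 1 (1 : Matrix (Fin 1) (Fin 1) L)).Local v) :
    γ ∈ levelTwoP L 1 (1 : Matrix (Fin 1) (Fin 1) L) v 1 ↔
      (∃ t ∈ localIntegers L v, mat L 1 (1 : Matrix (Fin 1) (Fin 1) L) v γ 0 0 = 1 + twoP L v * t) ∧
      (∃ t ∈ localIntegers L v, mat L 1 (1 : Matrix (Fin 1) (Fin 1) L) v γ⁻¹ 0 0 = 1 + twoP L v * t) := by
  rw [mem_levelTwoP_one_iff, mem_twoPIntMatrices_one_iff, mem_twoPIntMatrices_one_iff]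
  simp only [Matrix.sub_apply, Matrix.one_apply_eq, sub_eq_iff_eq_add']

end RankOne

end Summit.HodgeConjecture.HodgeConjecture.Cruxes.H413.K2E5BetaDetIndexCalculus

end
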